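import Summits.KontsevichZagierPeriods.KontsevichZagierPeriods.Theorems.TerasomaMultiplicationGammaHodgeSectorDefs
import Summits.KontsevichZagierPeriods.KontsevichZagierPeriods.Theorems.BetaCancellation.Negative.EulerReflectionStub
import Summits.KontsevichZagierPeriods.KontsevichZagierPeriods.Theorems.TerasomaMultiplicationBetaCancellationStubBetaTranslation
import Summits.KontsevichZagierPeriods.KontsevichZagierPeriods.Theorems.TerasomaMultiplicationTriplicationFromMultiplicationSimplex
import Summits.KontsevichZagierPeriods.KontsevichZagierPeriods.Theorems.TerasomaMultiplicationTriplicationFromMultiplicationAlgebra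

/-!
# `GammaHodgeFromRelators` (stmt-KontsevichZagierPeriods-14947) — the five Beta relator chains in
the formal period ring

Helper file for the relator compiler: the standard one- and two-letter relators of the Beta symbol
group hold in `P = KZ.FormalPeriodRing` (classes `betaClass a b = ⟦[(0,1), t^{a−1}(1−t)^{b−1}]⟧`
of `TerasomaMultiplicationGammaHodgeSectorDefs`):

* symmetry `β(a,b) = β(b,a)` — one rule-2 move `t ↦ 1 − t` (`TriplicationGlue.beta_symm`);
* unit `β(1,1) = 1` — the unit slab `[(0,1),1] × [pt,1] ∼ [pt,1]` (`TriplicationGlue.unit_prod`);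
* translation `β(a,b) = κ((a+b)/a)·β(a+1,b)` — one Newton–Leibniz move with the monomial primitive
  `t^a(1−t)^b` (`BetaCancellationLine.stub_betaTranslation`) and two symmetries;
* Dirichlet re-association `β(a,b)β(a+b,c) = β(b,c)β(a,b+c)` — two rule-2 moves through the
  Dirichlet simplex (`TriplicationGlue.reassoc`) and a symmetry;
* Euler reflection `β(a,1−a) = κ(1/sin πa)·β(½,½)` from `EulerReflectionRational` (item 3383, a
  hypothesis) and the four-move chain `[β(½,½)] ∼ [π]` (`equivalent_betaHalfRep_piRep`).

References: Andrews–Askey–Roy 1999, §1.1 and Thm 1.8.1; Kontsevich–Zagier 2001 §1.2.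
-/

noncomputable section

open MeasureTheory Set
open scoped BigOperators

namespace Summit.KontsevichZagierPeriods.TerasomaMultiplication.GammaHodgeFromRelators

open Literature.NumberTheory.Transcendental
open Literature.NumberTheory.Transcendental.KZ
open Summit.KontsevichZagierPeriods.GammaHodgeSectorKO
open Summit.KontsevichZagierPeriods.KontsevichZagierPeriods.BetaCancellationNegative
  (betaKernel mem_unitIoo polyKernelRep betaHalfRep betaHalfRep_integrand
   equivalent_betaHalfRep_piRep isAlgebraic_sin_pi_mul_rat betaKernel_one_one)
open Summit.KontsevichZagierPeriods.KontsevichZagierPeriods.BetaCancellationLine (stub_betaTranslation)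
open Summit.KontsevichZagierPeriods.TerasomaMultiplication.TriplicationGlue
  (beta_symm reassoc integrableOn_beta mellinBox_bF_eq mellinIntegrand_bF unit_prod)
open Summit.KontsevichZagierPeriods.KontsevichZagierPeriods.Theses.CompiledSubstitutions
  (EulerReflectionRational)

/-- The Beta family `(X₀, 1 − X₀)` on `ℝ¹` (local notation `bF`). -/
local notation "bF" => (![MvPolynomial.X 0, 1 - MvPolynomial.X 0] : Fin 2 → MvPolynomial (Fin 1) ℚ)

/-! ## Pinned Beta representations -/

/-- The Euler–Mellin Beta representation `ofMellin bF (a−1,b−1) 1` is pinned as `β(a,b)`.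
[folklore] -/
theorem isBetaRep_ofMellin (a b : ℚ)
    (h : IntegrableOn (mellinIntegrand bF ![a - 1, b - 1] 1) (mellinBox bF) volume) :
    IsBetaRep a b (IntegralRep.ofMellin bF ![a - 1, b - 1] 1 h) :=
  ⟨by rw [IntegralRep.ofMellin_domain, mellinBox_bF_eq], fun x _ => by
    rw [IntegralRep.ofMellin_integrand, mellinIntegrand_bF]⟩

/-- The class of the Euler–Mellin Beta representation is `betaClass a b`. [folklore] -/
theorem toFormalPeriod_ofMellin (a b : ℚ) (ha : 0 < a) (hb : 0 < b)
    (h : IntegrableOn (mellinIntegrand bF ![a - 1, b - 1] 1) (mellinBox bF) volume) :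
    toFormalPeriod (of (IntegralRep.ofMellin bF ![a - 1, b - 1] 1 h)) = betaClass a b :=
  (isBetaRep_ofMellin a b h).toFormalPeriod_eq ha hb

/-- `κ` of a rational: algebraicity witness. [folklore] -/
theorem isAlgebraic_ratCast (q : ℚ) : IsAlgebraic ℚ ((q : ℚ) : ℝ) := isAlgebraic_rat ℚ q

/-! ## Symmetry -/

/-- **Symmetry in `P`**: `β(a,b) = β(b,a)`. [cite: AndrewsAskeyRoy1999, §1.1 (1.1.13)] -/
theorem betaClass_symm (a b : ℚ) (ha : 0 < a) (hb : 0 < b) : betaClass a b = betaClass b a := by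
  rw [← toFormalPeriod_ofMellin a b ha hb (integrableOn_beta ha hb),
    ← toFormalPeriod_ofMellin b a hb ha (integrableOn_beta hb ha)]
  exact (beta_symm (integrableOn_beta ha hb) (integrableOn_beta hb ha)).toFormalPeriod_eq

/-! ## Unit -/

/-- `[(0,1), 1]` is pinned as `β(1,1)`. [folklore] -/
theorem isBetaRep_polyKernelRep_one : IsBetaRep 1 1 (polyKernelRep 1) :=
  ⟨rfl, fun x _ => by simp [betaKernel_one_one]⟩

/-- **Unit in `P`**: `β(1,1) = 1` (`[(0,1),1] = [(0,1),1]·[pt,1] ∼ [pt,1]`). [folklore] -/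
theorem betaClass_one_one : betaClass 1 1 = 1 := by
  rw [← isBetaRep_polyKernelRep_one.toFormalPeriod_eq one_pos one_pos]
  have h2 : toFormalPeriod (of (polyKernelRep 1)) * 1 = 1 := by
    rw [← toFormalPeriod_of_unit, toFormalPeriod_of_mul_of]
    exact (unit_prod IntegralRep.unit).toFormalPeriod_eq
  rwa [mul_one] at h2

/-! ## Translation -/

/-- `⟦[σ, q·f]⟧ = κ(q)·⟦[σ, f]⟧`: the product `[pt, q] × [σ, f]` is a relabelling of `[σ, q f]`
(one change-of-variables move, `KZ.of_sub_of_reindex_mem_relations`). [folklore] -/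
theorem toFormalPeriod_of_constMul {n : ℕ} (s : IntegralRep n) (q : ℝ) (hq : IsAlgebraic ℚ q) :
    toFormalPeriod (of (s.constMul q hq)) = kap q hq * toFormalPeriod (of s) := by
  rw [kap, toFormalPeriod_of_mul_of]
  have h1 : (IntegralRep.unit.constMul q hq).prod s =
      (s.constMul q hq).reindex (finCongr (Nat.zero_add n).symm) := by
    have hcoord : ∀ (w : Fin (0 + n) → ℝ),
        (fun j => w (Fin.natAdd 0 j)) = fun i => w (finCongr (Nat.zero_add n).symm i) := by
      intro w; funext j; simp
    refine IntegralRep.ext' ?_ ?_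
    · ext w
      simp only [IntegralRep.prod_domain, IntegralRep.mem_prodDomain, IntegralRep.domain_constMul,
        IntegralRep.unit_domain, mem_univ, true_and, IntegralRep.reindex_domain, mem_setOf_eq, hcoord]
    · rw [IntegralRep.prod_integrand_eq, IntegralRep.reindex_integrand]
      funext w
      simp only [IntegralRep.prodFun_apply, IntegralRep.integrand_constMul,
        IntegralRep.unit_integrand, mul_one, hcoord]
  rw [h1]
  exact toFormalPeriod_eq_iff.mpr (of_sub_of_reindex_mem_relations _ _)

/-- Translation in the second letter, in `P`: `κ(b)·β(a,b) = κ(a+b)·β(a,b+1)`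
(`stub_betaTranslation`: one Newton–Leibniz move, primitive `t^a(1−t)^b`). [folklore] -/
theorem kap_mul_betaClass_eq_kap_mul_betaClass_succ (a b : ℚ) (ha : 0 < a) (hb : 0 < b) :
    kap ((b : ℚ) : ℝ) (isAlgebraic_ratCast b) * betaClass a b =
      kap (((a + b : ℚ)) : ℝ) (isAlgebraic_ratCast (a + b)) * betaClass a (b + 1) := by
  have hb1 : 0 < b + 1 := by linarith
  set ρ : IntegralRep 1 := (betaRep a (b + 1) ha hb1).constMul (((a + b : ℚ)) : ℝ)
    (isAlgebraic_ratCast (a + b)) with hρ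
  set ρ' : IntegralRep 1 := (betaRep a b ha hb).constMul ((b : ℚ) : ℝ) (isAlgebraic_ratCast b)
    with hρ'
  have hE : Equivalent ρ ρ' := by
    refine stub_betaTranslation a b ha hb ρ ρ' rfl ?_ rfl ?_
    · intro x _
      rw [hρ, IntegralRep.integrand_constMul, betaRep_integrand]
      simp only [betaKernel]
      push_cast
      ring_nf
    · intro x _
      rw [hρ', IntegralRep.integrand_constMul, betaRep_integrand]
      rfl
  have h := hE.toFormalPeriod_eq
  rw [hρ, hρ', toFormalPeriod_of_constMul, toFormalPeriod_of_constMul, ← betaClass_eq,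
    ← betaClass_eq] at h
  exact h.symm

/-- **Translation in `P`**: `β(a,b) = κ((a+b)/a)·β(a+1,b)`, a positive-constant multiple.
[cite: AndrewsAskeyRoy1999, §1.1] -/
theorem isConstMultiple_betaClass_transl (a b : ℚ) (ha : 0 < a) (hb : 0 < b) :
    IsConstMultiple (betaClass a b) (betaClass (a + 1) b) := by
  have hab : (0 : ℝ) < (((b + a : ℚ)) : ℝ) := by exact_mod_cast (by linarith : 0 < b + a)
  have ha0 : (((a : ℚ)) : ℝ) ≠ 0 := by exact_mod_cast ha.ne'
  -- κ(a)·β(b,a) = κ(b+a)·β(b,a+1), then symmetries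
  have h := kap_mul_betaClass_eq_kap_mul_betaClass_succ b a hb ha
  rw [betaClass_symm b a hb ha, betaClass_symm b (a + 1) hb (by linarith)] at h
  -- divide by κ(a)
  refine ⟨(((a : ℚ)) : ℝ)⁻¹ * (((b + a : ℚ)) : ℝ), (isAlgebraic_ratCast a).inv.mul (isAlgebraic_ratCast _),
    mul_pos (inv_pos.mpr (by exact_mod_cast ha)) hab, ?_⟩
  rw [kap_mul _ _ (isAlgebraic_ratCast a).inv (isAlgebraic_ratCast (b + a)), mul_assoc, ← h, ← mul_assoc, mul_comm (kap _ _) (kap _ (isAlgebraic_ratCast a)),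
    kap_mul_kap_inv (isAlgebraic_ratCast a) ha0, one_mul]

/-! ## Dirichlet re-association -/

/-- **Dirichlet re-association in `P`**: `β(a,b)·β(a+b,c) = β(b,c)·β(a,b+c)`
(`TriplicationGlue.reassoc`: Dirichlet chart, swap, flip, Dirichlet chart backwards; then a
symmetry). [cite: AndrewsAskeyRoy1999, Thm 1.8.1] -/
theorem betaClass_reassoc (a b c : ℚ) (ha : 0 < a) (hb : 0 < b) (hc : 0 < c) :
    betaClass a b * betaClass (a + b) c = betaClass b c * betaClass a (b + c) := by
  have hab : 0 < a + b := by linarith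
  have hbc : 0 < b + c := by linarith
  have h := (reassoc ha hb hc rfl rfl (integrableOn_beta ha hb) (integrableOn_beta hab hc)
    (integrableOn_beta hb hc) (integrableOn_beta hbc ha)).toFormalPeriod_eq
  rw [← toFormalPeriod_of_mul_of, ← toFormalPeriod_of_mul_of, toFormalPeriod_ofMellin a b ha hb,
    toFormalPeriod_ofMellin (a + b) c hab hc, toFormalPeriod_ofMellin b c hb hc,
    toFormalPeriod_ofMellin (b + c) a hbc ha, betaClass_symm (b + c) a hbc ha] at h
  exact h

/-! ## Euler reflection -/

/-- `betaHalfRep` is pinned as `β(½,½)`. [folklore] -/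
theorem isBetaRep_betaHalfRep : IsBetaRep (1 / 2) (1 / 2) betaHalfRep :=
  ⟨rfl, fun x _ => by rw [betaHalfRep_integrand]⟩

/-- `β(½,½) = ⟦[π]⟧` in `P` (the four-move chain `equivalent_betaHalfRep_piRep`). [folklore] -/
theorem betaClass_half_half_eq_piRep :
    betaClass (1 / 2) (1 / 2) = toFormalPeriod (of piRep) := by
  rw [← isBetaRep_betaHalfRep.toFormalPeriod_eq (by norm_num) (by norm_num)]
  exact equivalent_betaHalfRep_piRep.toFormalPeriod_eq

/-- **Euler reflection in `P`** from `EulerReflectionRational` (item 3383): for rational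
`0 < a < 1`, `κ(sin πa)·β(a,1−a) = ⟦[π]⟧ = β(½,½)`, hence `β(a,1−a) = κ(1/sin πa)·β(½,½)` with
`1/sin πa > 0` real algebraic. [cite: AndrewsAskeyRoy1999, Thm 1.2.1] -/
theorem isConstMultiple_betaClass_refl (hE : EulerReflectionRational) (a : ℚ) (ha : 0 < a)
    (ha1 : a < 1) : IsConstMultiple (betaClass a (1 - a)) (betaClass (1 / 2) (1 / 2)) := by
  have h1a : 0 < 1 - a := by linarith
  set s : ℝ := Real.sin (Real.pi * a) with hs_def
  have hs : IsAlgebraic ℚ s := isAlgebraic_sin_pi_mul_rat ha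
  have hs0 : 0 < s := by
    refine Real.sin_pos_of_pos_of_lt_pi (by positivity) ?_
    have : (a : ℝ) < 1 := by exact_mod_cast ha1
    nlinarith [Real.pi_pos]
  have hEq : Equivalent ((betaRep a (1 - a) ha h1a).constMul s hs) piRep := by
    refine hE a ha ha1 _ _ rfl ?_ rfl (fun _ _ => rfl)
    intro x _
    rw [IntegralRep.integrand_constMul, betaRep_integrand]
    simp only [betaKernel, hs_def]
    push_cast
    ring_nf
  have key : kap s hs * betaClass a (1 - a) = betaClass (1 / 2) (1 / 2) := by
    rw [betaClass_half_half_eq_piRep, ← hEq.toFormalPeriod_eq, toFormalPeriod_of_constMul,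
      ← betaClass_eq]
  refine ⟨s⁻¹, hs.inv, inv_pos.mpr hs0, ?_⟩
  rw [← key, ← mul_assoc, mul_comm (kap s⁻¹ _), kap_mul_kap_inv hs hs0.ne', one_mul]

end Summit.KontsevichZagierPeriods.TerasomaMultiplication.GammaHodgeFromRelators

end
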